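import Summits.ValiantsHypothesis.ValiantsHypothesis.Theorems.BarrierLeverDefinableEquationsHighestWeightVector
import Summits.ValiantsHypothesis.ValiantsHypothesis.Theorems.BarrierLeverDefinableDcEquationsIsobaric

/-!
# Crux `BarrierLever.DefinableDcEquations` (stmt-ValiantsHypothesis-8746) — NORMAL FORM: the
# witness may be taken to be a HIGHEST WEIGHT VECTOR (and the extraction for any Borel-stable pair)

By-product of the normal-form programme for 8745/8749 (design memo `HWV-NORMAL-FORM-PLAN.md`;
`…UnipotentNormalForm/HighestWeightVector.lean`).  The `U`-invariant extraction (`uEq_of_eq`) and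
the torus extraction keeping `U`-invariance (`isoUEq_of_uEq`) are restated for an arbitrary pair of
classes `P ⊆ P'` such that every unipotent (resp. torus) translate of a member of `P` lies in `P'`
(`uEq_of_eq_of_stable`, `isoUEq_of_uEq_of_stable`).  The determinantal slice
`{deg ≤ n, dc ≤ M}` is stable ON THE NOSE under both (`dcSlice_unipStable` =
`unipotent_mem_dcSlice` of `…UnipotentTranslates.lean`; `dcSlice_torusStable`, g5), whence
THEOREM (`definableDcEquations_iff_highestWeightVector`): crux 8746 holds iff it holds with witnesses
that are torus weight vectors invariant under the unipotent radical — highest weight vectors —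
with the same threshold function `m` and level `a ↦ a + 7`.

HONEST FRAMING.  A normal form; nothing here bears on the open content of 8746 (the dc-axis rung
is at its wall `n + Θ(c n / log n)`, g2), on 8745/8749 (Chatterjee–Tengse 2023 §1.3 dir. 2), 14610
or VP vs VNP.  No definitions, no named facts.  References: [LandsbergGCT2017] §8;
[MignonRessayre2004] §1; [ForbesShpilkaVolk2018] Def. 1.
-/

-- layout Summits/ValiantsHypothesis/ValiantsHypothesis forces the duplicated namespace component
set_option linter.dupNamespace false

noncomputable section

open MvPolynomial

namespace Summit.ValiantsHypothesis.ValiantsHypothesis.Theorems.BarrierLever.IsobaricEquations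

open Literature.Computability.AlgebraicComplexity Literature.Barriers.ValiantsHypothesis
open Summit.ValiantsHypothesis.ValiantsHypothesis.Theorems.BarrierLever.SuccinctHittingSetsForVP
open Summit.ValiantsHypothesis.ValiantsHypothesis.Theorems.BarrierLever.BoolSumComponents

variable {n : ℕ}

/-! ## The two extractions for stable pairs of classes -/

/-- **The `U`-invariant extraction for a `U`-stable pair `P ⊆ P'`** (`n ≥ 64`, `n ≥ 2a + 6`): from
a nonzero level-`a` Boolean-sum equation for `coeff(P')` one obtains a nonzero level-`(a+4)`
Boolean-sum equation for `coeff(P)` which is invariant under the coefficient action of every upper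
unitriangular substitution, provided every unipotent translate of a member of `P` lies in `P'` and
`P` consists of polynomials of degree `≤ n`. [folklore] -/
theorem uEq_of_eq_of_stable [Fintype (degLEMonomials n)] {a : ℕ} (hn : 64 ≤ n) (ha : 2 * a + 6 ≤ n)
    {P P' : Set (MvPolynomial (Fin n) ℂ)} (hP : ∀ f ∈ P, f.totalDegree ≤ n)
    (hstab : ∀ f ∈ P, ∀ s : Fin n → Fin n → ℂ, aeval (unip s) f ∈ P')
    {q : ℕ} (hq : q ≤ (Nat.choose (2 * n) n) ^ a) (H : MvPolynomial (↥(degLEMonomials n) ⊕ Fin q) ℂ)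
    (hc : complexity H ≤ (Nat.choose (2 * n) n) ^ a) (hd : H.totalDegree ≤ (Nat.choose (2 * n) n) ^ a)
    (hne : boolSum H ≠ 0)
    (hvan : ∀ f ∈ P', eval (coeffVector (degLEMonomials n) f) (boolSum H) = 0) :
    ∃ q' : ℕ, q' ≤ (Nat.choose (2 * n) n) ^ (a + 4) ∧
      ∃ H' : MvPolynomial (↥(degLEMonomials n) ⊕ Fin q') ℂ,
        complexity H' ≤ (Nat.choose (2 * n) n) ^ (a + 4) ∧
        H'.totalDegree ≤ (Nat.choose (2 * n) n) ^ (a + 4) ∧ boolSum H' ≠ 0 ∧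
        (∀ f ∈ P, eval (coeffVector (degLEMonomials n) f) (boolSum H') = 0) ∧
        ∀ (t : Fin n → Fin n → ℂ) (c : degLEMonomials n → ℂ),
          eval (uAct t c) (boolSum H') = eval c (boolSum H') := by
  classical
  obtain ⟨h5, hnN, -, -⟩ := N_arith hn
  obtain ⟨h9, hsq, h13, hcube⟩ := uN_arith hn
  set N := (2 * n).choose n with hNdef
  set E := boolSum H with hEdef
  set HG := genHomH q (pairList n) (rename (Sum.map Sum.inr id) H) with hHGdef
  set G := boolSum HG with hGdef
  have hG : ∀ (s : Fin n → Fin n → ℂ) (c : degLEMonomials n → ℂ),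
      eval (spt s c) G = eval (uAct s c) E := eval_boolSum_genTranslate H
  set D := weightedTotalDegree (heightW n) G with hDdef
  -- `G ≠ 0`, hence `G_top ≠ 0`
  have hGne : G ≠ 0 := by
    intro h0
    apply hne
    refine MvPolynomial.funext fun c => ?_
    rw [map_zero, hEdef, ← uAct_zero c, ← hG, h0, map_zero]
  have hGtop : weightedHomogeneousComponent (heightW n) D G ≠ 0 :=
    weightedHomogeneousComponent_top_ne_zero (heightW n) hGne
  -- the weighted degree is `< 2^N`
  have hK : weightedTotalDegree (heightW n) G < 2 ^ N := by
    refine (weightedTotalDegree_le (heightW n) n heightW_le G).trans_lt ?_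
    refine (Nat.mul_le_mul_right n ((totalDegree_boolSum_le HG).trans
      ((totalDegree_genTranslate_le H).trans (Nat.mul_le_mul_right _ hd)))).trans_lt ?_
    exact u_wdeg_arith hn ha
  -- Fourier extraction of the top root-height component
  obtain ⟨H', hsum', hc', hd'⟩ :=
    exists_boolSum_eq_weightedHomogeneousComponent (heightW n) HG (L := N) (J := D) hK hK
  -- specialise the `s`-variables
  obtain ⟨s₀, hs₀⟩ := exists_aeval_const_ne_zero hGtop
  obtain ⟨lq, lc, ld⟩ := u_level_arith (a := a) (q := q) (c := complexity H) (d := H.totalDegree)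
    h9 hsq h13 hcube hq hc hd
  refine ⟨q + N, lq, aeval (Sum.elim (fun v => rename Sum.inl
    ((Sum.elim (fun p => C (s₀ p)) X :
      (Fin n × Fin n) ⊕ degLEMonomials n → MvPolynomial (degLEMonomials n) ℂ) v))
    (fun j => X (Sum.inr j))) H', ?_, ?_, ?_, ?_, ?_⟩
  · -- size
    refine (complexity_aeval_le _ _).trans ?_
    have hzero : ∑ v : ((Fin n × Fin n) ⊕ degLEMonomials n) ⊕ Fin (q + N), complexity
        (Sum.elim (fun v => rename Sum.inl ((Sum.elim (fun p => C (s₀ p)) X :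
          (Fin n × Fin n) ⊕ degLEMonomials n → MvPolynomial (degLEMonomials n) ℂ) v))
          (fun j => X (Sum.inr j)) v : MvPolynomial (degLEMonomials n ⊕ Fin (q + N)) ℂ) = 0 := by
      refine Finset.sum_eq_zero fun v _ => ?_
      rcases v with (p | m) | j
      · simp only [Sum.elim_inl, rename_C]; exact complexity_C_holds _
      · simp only [Sum.elim_inl, Sum.elim_inr, rename_X]; exact complexity_X_holds _
      · simp only [Sum.elim_inr]; exact complexity_X_holds _
    rw [hzero, add_zero]
    have hcg : complexity HG ≤ complexity H + n * n * (N * ((n + 1) * (n + 3))) := by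
      have := complexity_genTranslate_le (n := n) H
      rw [card_degLEMonomials, ← hNdef] at this
      exact this
    rw [Fintype.card_sum, Fintype.card_prod, Fintype.card_fin, card_degLEMonomials, ← hNdef] at hc'
    generalize n * n * (N * ((n + 1) * (n + 3))) = A at hcg lc
    generalize (n * n + N) * (3 * N + 1) = B at hc' lc
    omega
  · -- degree
    rw [show aeval _ H' = bind₁ _ H' from rfl]
    refine (Literature.Barriers.ValiantsHypothesis.FSV2018.totalDegree_bind₁_le_mul _ 1 (fun v => ?_)
      H').trans ?_
    · rcases v with (p | m) | j
      · simp only [Sum.elim_inl, rename_C, totalDegree_C]; exact Nat.zero_le _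
      · simp only [Sum.elim_inl, Sum.elim_inr, rename_X, totalDegree_X]; exact le_rfl
      · simp only [Sum.elim_inr, totalDegree_X]; exact le_rfl
    · rw [mul_one]
      have hdg : HG.totalDegree ≤ H.totalDegree * (1 + n * n * n) := totalDegree_genTranslate_le H
      have hdg' : HG.totalDegree * (N + 1) ≤ H.totalDegree * (1 + n * n * n) * (N + 1) :=
        Nat.mul_le_mul_right _ hdg
      omega
  · -- nonzero
    rw [BoolSumComponents.boolSum_aeval_inl, hsum']
    exact hs₀
  · -- vanishing on `coeff(P)`
    intro f hf
    rw [BoolSumComponents.boolSum_aeval_inl, hsum', eval_aeval_const]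
    refine eval_component_eq_zero_of_forall (fun s => ?_) _ D
    rw [hG, uAct_coeffVector s f (hP f hf)]
    exact hvan _ (hstab f hf s)
  · -- `U`-invariance
    intro t c
    rw [BoolSumComponents.boolSum_aeval_inl, hsum', eval_aeval_const, eval_aeval_const]
    convert eval_top_uAct hG t (fun i j => s₀ (i, j)) c using 2

/-- **The torus extraction for a torus-stable pair `P ⊆ P'` keeps `U`-invariance**
(`n ≥ 64`, `n ≥ 2a + 6`; `isoEq_of_eq_of_stable` of `…DefinableDcEquationsIsobaric.lean` plus
`eval_uAct_component`). [folklore] -/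
theorem isoUEq_of_uEq_of_stable [Fintype (degLEMonomials n)] {a : ℕ} (hn : 64 ≤ n) (ha : 2 * a + 6 ≤ n)
    {P P' : Set (MvPolynomial (Fin n) ℂ)}
    (hstab : ∀ f ∈ P, ∀ (t : ℂ) (u₀ : ℕ) (u : Fin n → ℕ),
      C (t ^ u₀) * aeval (fun i => C (t ^ u i) * X i) f ∈ P')
    {q : ℕ} (hq : q ≤ (Nat.choose (2 * n) n) ^ a) (H : MvPolynomial (↥(degLEMonomials n) ⊕ Fin q) ℂ)
    (hc : complexity H ≤ (Nat.choose (2 * n) n) ^ a) (hd : H.totalDegree ≤ (Nat.choose (2 * n) n) ^ a)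
    (hne : boolSum H ≠ 0)
    (hvan : ∀ f ∈ P', eval (coeffVector (degLEMonomials n) f) (boolSum H) = 0)
    (hinv : ∀ (t : Fin n → Fin n → ℂ) (c : degLEMonomials n → ℂ),
      eval (uAct t c) (boolSum H) = eval c (boolSum H)) :
    ∃ q' : ℕ, q' ≤ (Nat.choose (2 * n) n) ^ (a + 3) ∧
      ∃ H' : MvPolynomial (↥(degLEMonomials n) ⊕ Fin q') ℂ,
        complexity H' ≤ (Nat.choose (2 * n) n) ^ (a + 3) ∧
        H'.totalDegree ≤ (Nat.choose (2 * n) n) ^ (a + 3) ∧ boolSum H' ≠ 0 ∧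
        (∀ f ∈ P, eval (coeffVector (degLEMonomials n) f) (boolSum H') = 0) ∧
        (boolSum H').support ⊆ (boolSum H).support ∧
        (∀ (t : Fin n → Fin n → ℂ) (c : degLEMonomials n → ℂ),
          eval (uAct t c) (boolSum H') = eval c (boolSum H')) ∧
        ∃ (d : ℕ) (w : Fin n → ℕ), (boolSum H').IsHomogeneous d ∧
          ∀ i : Fin n, IsWeightedHomogeneous
            (fun m : degLEMonomials n => (m : Fin n →₀ ℕ) i) (boolSum H') (w i) := by
  -- adapted from `isoEq_of_eq_of_stable` (…DefinableDcEquationsIsobaric.lean), plus `U`-invariance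
  classical
  obtain ⟨h5, hnN, -, -⟩ := N_arith hn
  set N := (2 * n).choose n with hNdef
  set E := boolSum H with hEdef
  set B := n * N ^ a + 1 with hBdef
  set W : degLEMonomials n → ℕ := fun m => B ^ n + ∑ i : Fin n, B ^ (i : ℕ) * (m : Fin n →₀ ℕ) i
    with hWdef
  have hB : 0 < B := Nat.succ_pos _
  have hdegE : E.totalDegree ≤ N ^ a := (totalDegree_boolSum_le H).trans hd
  have hWmax : ∀ m : degLEMonomials n, W m ≤ (n + 1) * B ^ n := by
    intro m
    have hB1 : 1 ≤ B := hB
    have hsum : ∑ i : Fin n, B ^ (i : ℕ) * (m : Fin n →₀ ℕ) i ≤ B ^ n * n := by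
      calc ∑ i : Fin n, B ^ (i : ℕ) * (m : Fin n →₀ ℕ) i
          ≤ ∑ i : Fin n, B ^ n * (m : Fin n →₀ ℕ) i := Finset.sum_le_sum fun i _ =>
            Nat.mul_le_mul_right _ (Nat.pow_le_pow_right hB1 i.2.le)
        _ = B ^ n * ∑ i : Fin n, (m : Fin n →₀ ℕ) i := by rw [Finset.mul_sum]
        _ ≤ B ^ n * n := Nat.mul_le_mul_left _ ?_
      calc ∑ i : Fin n, (m : Fin n →₀ ℕ) i = (m : Fin n →₀ ℕ).degree := by
            rw [Finsupp.degree_apply]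
            exact (Finset.sum_subset (Finset.subset_univ _) fun i _ hi =>
              Finsupp.notMem_support_iff.mp hi).symm
        _ ≤ n := m.2
    calc W m = B ^ n + ∑ i : Fin n, B ^ (i : ℕ) * (m : Fin n →₀ ℕ) i := rfl
      _ ≤ B ^ n + B ^ n * n := Nat.add_le_add_left hsum _
      _ = (n + 1) * B ^ n := by ring
  have hK : weightedTotalDegree W E < 2 ^ N := by
    calc weightedTotalDegree W E ≤ E.totalDegree * ((n + 1) * B ^ n) :=
          weightedTotalDegree_le W _ hWmax E
      _ ≤ N ^ a * ((n + 1) * B ^ n) := Nat.mul_le_mul_right _ hdegE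
      _ < 2 ^ N := wdeg_arith hn ha
  obtain ⟨J, hJmem, hJne⟩ : ∃ J ∈ Finset.range (weightedTotalDegree W E + 1),
      weightedHomogeneousComponent W J E ≠ 0 := by
    by_contra hall
    push Not at hall
    apply hne
    rw [hEdef, ← Isobaric.sum_weightedHomogeneousComponent_range W (boolSum H)
      (weightedTotalDegree W E) (fun d hd => le_weightedTotalDegree W hd)]
    exact Finset.sum_eq_zero hall
  have hJ : J < 2 ^ N := lt_of_le_of_lt (Nat.lt_succ_iff.mp (Finset.mem_range.mp hJmem)) hK
  obtain ⟨H', hsum', hc', hd'⟩ :=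
    exists_boolSum_eq_weightedHomogeneousComponent W H (L := N) (J := J) hK hJ
  obtain ⟨lq, lc, ld⟩ := level_arith (a := a) (q := q) (c := complexity H) (d := H.totalDegree)
    h5 hq hc hd
  have hsupp : (weightedHomogeneousComponent W J E).support ⊆ E.support := by
    intro α hα
    rw [mem_support_iff, coeff_weightedHomogeneousComponent] at hα
    rw [mem_support_iff]
    intro h0; exact hα (by rw [h0, ite_self])
  refine ⟨q + N, lq, H', ?_, hd'.trans ld, ?_, ?_, ?_, ?_, ?_⟩
  · refine hc'.trans ?_
    rw [card_degLEMonomials]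
    exact lc
  · rw [hsum']; exact hJne
  · intro f hf
    rw [hsum']
    exact eval_component_eq_zero_of_stable hstab hvan (B ^ n) (fun i => B ^ (i : ℕ)) J hf
  · rw [hsum']; exact hsupp
  · intro t c
    rw [hsum']
    exact eval_uAct_component hinv (B ^ n) (fun i => B ^ (i : ℕ)) J t c
  · rw [hsum']
    refine weightVector_of_combined hB (weightedHomogeneousComponent_isWeightedHomogeneous J E)
      (fun α hα => ?_) hJne
    have hdegα : α.degree ≤ N ^ a := by
      rw [Finsupp.degree_apply]
      exact (le_totalDegree (hsupp hα)).trans hdegE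
    constructor
    · calc n * α.degree ≤ n * N ^ a := Nat.mul_le_mul_left _ hdegα
        _ < B := Nat.lt_succ_self _
    · calc α.degree ≤ N ^ a := hdegα
        _ ≤ n * N ^ a := Nat.le_mul_of_pos_left _ (by omega)
        _ < B := Nat.lt_succ_self _


/-! ## Crux 8746 in highest-weight-vector normal form -/

/-- **The determinantal slice `{deg ≤ n, dc ≤ M}` is `U`-stable** (on the nose).
[cite: MignonRessayre2004, §1] -/
theorem dcSlice_unipStable {M : ℕ} :
    ∀ f ∈ {f : MvPolynomial (Fin n) ℂ | f.totalDegree ≤ n ∧ determinantalComplexity f ≤ M},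
      ∀ s : Fin n → Fin n → ℂ, aeval (unip s) f ∈
        {f : MvPolynomial (Fin n) ℂ | f.totalDegree ≤ n ∧ determinantalComplexity f ≤ M} :=
  fun _ hf s => unipotent_mem_dcSlice s hf

/-- **`DefinableDcEquations` in highest-weight-vector normal form** (crux stmt-ValiantsHypothesis-8746):
the crux holds iff it holds with witnesses whose Boolean sum is a torus weight vector (homogeneous
`d`, isobaric `w_i` for every coordinate grading) invariant under every upper unitriangular
substitution — a highest weight vector of weight `(d; w)` — with the same threshold function `m`
and level `a ↦ a + 7` (the slice `{deg ≤ n, dc ≤ m(n)}` is Borel-stable on the nose).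
[cite: LandsbergGCT2017, §8] -/
theorem definableDcEquations_iff_highestWeightVector :
    Summit.ValiantsHypothesis.ValiantsHypothesis.Theses.BarrierLever.DefinableDcEquations ↔
      ∃ m : ℕ → ℕ, (∀ C : ℕ, ∃ n₀ : ℕ, ∀ n ≥ n₀, 2 ^ (C * (Nat.log 2 n + 1) ^ 2) ≤ m n) ∧
        ∃ a n₀ : ℕ, ∀ n ≥ n₀, ∃ q : ℕ, q ≤ (Nat.choose (2 * n) n) ^ a ∧
          ∃ H : MvPolynomial (↥(degLEMonomials n) ⊕ Fin q) ℂ,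
            complexity H ≤ (Nat.choose (2 * n) n) ^ a ∧ H.totalDegree ≤ (Nat.choose (2 * n) n) ^ a ∧
            boolSum H ≠ 0 ∧
            (∀ f : MvPolynomial (Fin n) ℂ, f.totalDegree ≤ n → determinantalComplexity f ≤ m n →
              eval (coeffVector (degLEMonomials n) f) (boolSum H) = 0) ∧
            (∃ (d : ℕ) (w : Fin n → ℕ), (boolSum H).IsHomogeneous d ∧
              ∀ i : Fin n, IsWeightedHomogeneous
                (fun m : degLEMonomials n => (m : Fin n →₀ ℕ) i) (boolSum H) (w i)) ∧
            ∀ (t : Fin n → Fin n → ℂ) (f : MvPolynomial (Fin n) ℂ), f.totalDegree ≤ n →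
              eval (coeffVector (degLEMonomials n) (aeval (unip t) f)) (boolSum H) =
                eval (coeffVector (degLEMonomials n) f) (boolSum H) := by
  constructor
  · rintro ⟨m, hgrow, a, n₀, h⟩
    refine ⟨m, hgrow, a + 7, ?_⟩
    obtain ⟨n₁, hn₁⟩ := hgrow 0
    refine ⟨max n₀ (max n₁ (max 64 (2 * a + 14))), fun n hn => ?_⟩
    have hA := le_max_left n₀ (max n₁ (max 64 (2 * a + 14)))
    have hB := le_max_right n₀ (max n₁ (max 64 (2 * a + 14)))
    have hC := le_max_left n₁ (max 64 (2 * a + 14))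
    have hD := le_max_right n₁ (max 64 (2 * a + 14))
    have hE := le_max_left 64 (2 * a + 14)
    have hF := le_max_right 64 (2 * a + 14)
    classical
    haveI : Fintype (degLEMonomials n) := (Finsupp.finite_of_degree_le (σ := Fin n) n).fintype
    obtain ⟨q, hq, H, hc, hd, hne, hvan⟩ := h n (by omega)
    have hM : 1 ≤ m n := by
      have := hn₁ n (by omega)
      simpa using this
    set P : Set (MvPolynomial (Fin n) ℂ) :=
      {f | f.totalDegree ≤ n ∧ determinantalComplexity f ≤ m n} with hP
    have hvanP : ∀ f ∈ P, eval (coeffVector (degLEMonomials n) f) (boolSum H) = 0 :=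
      fun f hf => hvan f hf.1 hf.2
    obtain ⟨q₁, hq₁, H₁, hc₁, hd₁, hne₁, hvan₁, hinv₁⟩ :=
      uEq_of_eq_of_stable (a := a) (by omega) (by omega) (fun f hf => hf.1) dcSlice_unipStable
        hq H hc hd hne hvanP
    obtain ⟨q', hq', H', hc', hd', hne', hvan', -, hinv', d, w, hhom, hiso⟩ :=
      isoUEq_of_uEq_of_stable (a := a + 4) (by omega) (by omega) (dcSlice_torusStable hM)
        hq₁ H₁ hc₁ hd₁ hne₁ hvan₁ hinv₁
    exact ⟨q', hq', H', hc', hd', hne', fun f h1 h2 => hvan' f ⟨h1, h2⟩, ⟨d, w, hhom, hiso⟩,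
      fun t f hf => eval_coeffVector_aeval_unip_of_uAct hinv' t f hf⟩
  · rintro ⟨m, hgrow, a, n₀, h⟩
    refine ⟨m, hgrow, a, n₀, fun n hn => ?_⟩
    obtain ⟨q, hq, H, hc, hd, hne, hvan, -⟩ := h n hn
    exact ⟨q, hq, H, hc, hd, hne, hvan⟩

end Summit.ValiantsHypothesis.ValiantsHypothesis.Theorems.BarrierLever.IsobaricEquations

end
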